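import Literature.Geometry.Riemannian.HamiltonPCOPinchingThree
import Literature.Geometry.Riemannian.HamiltonPCOPinchingFourCore
import HarnessLib

/-!
# Hamilton 1986, Thm. 7.1, inequality (4): `(b₂ + b₃)^{2+ε} ≤ K a₁c₁` is preserved — proved
(topic `Geometry/Riemannian`)

Fourth brick of the pinching set of **Hamilton 1986, Thm. 7.1** (J. Differential Geom. 24,
p. 170; the ODE layer of `Literature.Geometry.Riemannian.hamilton_positiveCurvatureOperator_classification_four`,
see `HamiltonPCOPinchingOne/Two/Three.lean`). Hamilton, p. 173: on the set where (1)–(3) hold,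
Cor. 7.5 (`b ≤ (1 - η)a`) and Cor. 7.6 give `d/dt log [a₁c₁/(b₂ + b₃)²] ≥ λa`, while
`d/dt log (b₂ + b₃) ≤ 2b₁ + a₃ + c₃ ≤ 4a`; "Then if `ε` is small enough
`d/dt log [a₁c₁/(b₂ + b₃)^{2+ε}] ≥ 0` and it follows that the inequality
`(b₂ + b₃)^{2+ε} ≤ K a₁c₁` is preserved for any `K`."

PROVED here at the ODE level (`HamiltonODE.IsInvariantRel`), in closed variational form:

* `SingularValuesSumPowLEProd p K ε` — for all orthonormal pairs `(u₁, u₂)`, `(v₁, v₂)` and unit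
  `w`, `z`: `((u₁ᵀBv₁ + u₂ᵀBv₂)²)^{1+ε/2} ≤ K (wᵀAw)(zᵀCz)` (`= (b₂ + b₃)^{2+ε} ≤ K a₁c₁` on
  `{a₁, c₁ ≥ 0}`);
* `hamilton1986_pinchingFour_ode` — for `0 < m, G, J, K`, `0 < δ ≤ 1`, `8Hδ ≤ 1`, `4GHδ² ≤ 1`,
  an auxiliary `0 < η ≤ ½` with `16 · 8^δ J η^δ ≤ 1` (Cor. 7.5) and `0 < ε` with `12ε ≤ δη`,
  `144ε ≤ η²` ("if `ε` is small enough"), the set (4) is forward invariant under Hamilton's ODE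
  relative to `Z₃ = pcoPinchingThree m G H J δ` (itself invariant, `isInvariant_pcoPinchingThree`);
  whence the invariant closed convex `B ↦ -B`-symmetric set `pcoPinchingFour = Z₃ ∩ {(4)}`.

Proof: barrier lemma for `𝒢 = K X X_C - (Y²)^{1+ε/2}` over `pairSet² × unitSet²` (as for (1));
at a minimiser the logarithmic derivatives compare by `pcoFour_ell`
(`HamiltonPCOPinchingFourCore.lean`), using a maximiser `T` of `tr (BT)` for `b` and the
variational substitutes `tr (BT) ≤ 2(b₂ + b₃)`, `3b₁ ≤ b`, `2b₁ ≤ a₃ + c₃`.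

## References

* R. S. Hamilton, *Four-manifolds with positive curvature operator*, J. Differential Geom. 24
  (1986) 153–179: §7, Thm. 7.1 (p. 170), Lemma 7.2 (p. 171), Lemma 7.3, (7.4), Cor. 7.5 (p. 172),
  Cor. 7.6 and the proof of (4) (p. 173). [Hamilton1986]
-/

noncomputable section

open Set Real Filter
open scoped Matrix BigOperators Topology

namespace Literature.Geometry.Riemannian

namespace HamiltonODE

/-! ### The set (4) and the barrier functional -/

/-- **`(b₂ + b₃)^{2+ε} ≤ K a₁ c₁`** (Hamilton 1986, Thm. 7.1, inequality (4)), variationally and in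
closed form: for all orthonormal pairs `(u₁, u₂)`, `(v₁, v₂)` and unit `w`, `z`,
`((u₁ᵀBv₁ + u₂ᵀBv₂)²)^{1+ε/2} ≤ K (wᵀAw)(zᵀCz)`. [cite: Hamilton1986, §7, Thm. 7.1 (4) (p. 170)] -/
def SingularValuesSumPowLEProd (p : Blocks) (K ε : ℝ) : Prop :=
  ∀ u₁ u₂ v₁ v₂ w z : Fin 3 → ℝ,
    u₁ ⬝ᵥ u₁ = 1 → u₂ ⬝ᵥ u₂ = 1 → u₁ ⬝ᵥ u₂ = 0 → v₁ ⬝ᵥ v₁ = 1 → v₂ ⬝ᵥ v₂ = 1 → v₁ ⬝ᵥ v₂ = 0 →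
    w ⬝ᵥ w = 1 → z ⬝ᵥ z = 1 →
      ((u₁ ⬝ᵥ (p.2.1 *ᵥ v₁) + u₂ ⬝ᵥ (p.2.1 *ᵥ v₂)) ^ 2) ^ (1 + ε / 2) ≤
        K * (w ⬝ᵥ (p.1 *ᵥ w)) * (z ⬝ᵥ (p.2.2 *ᵥ z))

/-- The barrier functional `𝒢 = K X X_C - (Y²)^{1+ε/2}` on `pairSet² × unitSet²`. [folklore] -/
def pcoFourG (K ε : ℝ) (p : Blocks) (q : PP × UU) : ℝ :=
  K * (q.2.1 ⬝ᵥ (p.1 *ᵥ q.2.1)) * (q.2.2 ⬝ᵥ (p.2.2 *ᵥ q.2.2)) - (kyFanQ p.2.1 q.1 ^ 2) ^ (1 + ε / 2)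

/-- Its derivative along a curve with velocity `p'`. [folklore] -/
def pcoFourG' (K ε : ℝ) (p p' : Blocks) (q : PP × UU) : ℝ :=
  K * ((q.2.1 ⬝ᵥ (p'.1 *ᵥ q.2.1)) * (q.2.2 ⬝ᵥ (p.2.2 *ᵥ q.2.2)) +
      (q.2.1 ⬝ᵥ (p.1 *ᵥ q.2.1)) * (q.2.2 ⬝ᵥ (p'.2.2 *ᵥ q.2.2))) -
    (2 * kyFanQ p.2.1 q.1 * kyFanQ p'.2.1 q.1) * (1 + ε / 2) * (kyFanQ p.2.1 q.1 ^ 2) ^ (ε / 2)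

/-- (4) iff `𝒢 ≥ 0` on the parameter set. [folklore] -/
theorem singularValuesSumPowLEProd_iff (K ε : ℝ) (p : Blocks) :
    SingularValuesSumPowLEProd p K ε ↔ ∀ q ∈ pcoOneSet, 0 ≤ pcoFourG K ε p q := by
  constructor
  · rintro h ⟨⟨⟨u₁, u₂⟩, ⟨v₁, v₂⟩⟩, ⟨w, z⟩⟩ ⟨⟨⟨hu₁, hu₂, hu⟩, ⟨hv₁, hv₂, hv⟩⟩, ⟨hw, hz⟩⟩
    have := h u₁ u₂ v₁ v₂ w z hu₁ hu₂ hu hv₁ hv₂ hv hw hz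
    simp only [pcoFourG, kyFanQ]; linarith
  · intro h u₁ u₂ v₁ v₂ w z hu₁ hu₂ hu hv₁ hv₂ hv hw hz
    have := h (((u₁, u₂), (v₁, v₂)), (w, z)) ⟨⟨⟨hu₁, hu₂, hu⟩, ⟨hv₁, hv₂, hv⟩⟩, ⟨hw, hz⟩⟩
    simp only [pcoFourG, kyFanQ] at this; linarith

/-! ### Calculus and continuity -/

/-- Derivative of `𝒢` along a differentiable curve of blocks. [folklore] -/
theorem hasDerivAt_pcoFourG (K : ℝ) {ε : ℝ} (hε : 0 < ε) {γ : ℝ → Blocks} {γ' : Blocks} {s : ℝ}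
    (hγ : HasDerivAt γ γ' s) (q : PP × UU) :
    _root_.HasDerivAt (fun t ↦ pcoFourG K ε (γ t) q) (pcoFourG' K ε (γ s) γ' q) s := by
  have hX := hasDerivAt_quadForm hγ.1 q.2.1 q.2.1
  have hZ := hasDerivAt_quadForm hγ.2.2 q.2.2 q.2.2
  have hY := hasDerivAt_kyFanQ hγ.2.1 q.1
  have hS := (hY.pow 2).rpow_const (p := 1 + ε / 2) (Or.inr (by linarith))
  have h := ((hX.mul hZ).const_mul K).sub hS
  refine (h.congr_of_eventuallyEq (Filter.Eventually.of_forall fun t ↦ ?_)).congr_deriv ?_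
  · simp only [pcoFourG, Pi.mul_apply, Pi.sub_apply, Pi.pow_apply]
    ring
  · have e1 : (1 + ε / 2 - 1) = ε / 2 := by ring
    rw [e1]
    simp only [pcoFourG', Nat.cast_ofNat, Pi.pow_apply]
    ring

section Continuity

variable (K ε : ℝ)

/-- `(p, q) ↦ 𝒢` is continuous for `ε ≥ 0`. [folklore] -/
theorem continuous_pcoFourG (hε : 0 ≤ ε) : Continuous fun z : Blocks × (PP × UU) ↦ pcoFourG K ε z.1 z.2 := by
  unfold pcoFourG
  have hX := continuous_quadForm
  have hY := continuous_kyFanQ'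
  have hp : Continuous fun z : Blocks × (PP × UU) ↦ z.1 := continuous_fst
  have hq : Continuous fun z : Blocks × (PP × UU) ↦ z.2 := continuous_snd
  have hw := continuous_fst.comp (continuous_snd.comp hq)
  have hz := continuous_snd.comp (continuous_snd.comp hq)
  have hF := continuous_fst.comp hq
  refine ((continuous_const.mul (hX.comp ((continuous_fst.comp hp).prodMk (hw.prodMk hw)))).mul
    (hX.comp ((continuous_snd.comp (continuous_snd.comp hp)).prodMk (hz.prodMk hz)))).sub ?_
  exact ((hY.comp ((continuous_fst.comp (continuous_snd.comp hp)).prodMk hF)).pow 2).rpow_const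
    fun _ ↦ Or.inr (by linarith)

/-- `(p, p', q) ↦ 𝒢'` is continuous for `ε ≥ 0`. [folklore] -/
theorem continuous_pcoFourG' (hε : 0 ≤ ε) :
    Continuous fun z : Blocks × Blocks × (PP × UU) ↦ pcoFourG' K ε z.1 z.2.1 z.2.2 := by
  unfold pcoFourG'
  have hX := continuous_quadForm
  have hY := continuous_kyFanQ'
  have hp : Continuous fun z : Blocks × Blocks × (PP × UU) ↦ z.1 := continuous_fst
  have hp' : Continuous fun z : Blocks × Blocks × (PP × UU) ↦ z.2.1 := continuous_fst.comp continuous_snd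
  have hq : Continuous fun z : Blocks × Blocks × (PP × UU) ↦ z.2.2 := continuous_snd.comp continuous_snd
  have hw := continuous_fst.comp (continuous_snd.comp hq)
  have hz := continuous_snd.comp (continuous_snd.comp hq)
  have hF := continuous_fst.comp hq
  have hXp := hX.comp ((continuous_fst.comp hp).prodMk (hw.prodMk hw))
  have hXp' := hX.comp ((continuous_fst.comp hp').prodMk (hw.prodMk hw))
  have hZp := hX.comp ((continuous_snd.comp (continuous_snd.comp hp)).prodMk (hz.prodMk hz))
  have hZp' := hX.comp ((continuous_snd.comp (continuous_snd.comp hp')).prodMk (hz.prodMk hz))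
  have hYp := hY.comp ((continuous_fst.comp (continuous_snd.comp hp)).prodMk hF)
  have hYp' := hY.comp ((continuous_fst.comp (continuous_snd.comp hp')).prodMk hF)
  have hSε : Continuous fun z : Blocks × Blocks × (PP × UU) ↦ (kyFanQ z.1.2.1 z.2.2.1 ^ 2) ^ (ε / 2) :=
    (hYp.pow 2).rpow_const fun _ ↦ Or.inr (by linarith)
  exact (continuous_const.mul ((hXp'.mul hZp).add (hXp.mul hZp'))).sub
    ((((continuous_const.mul hYp).mul hYp').mul continuous_const).mul hSε)

attribute [local irreducible] pcoFourG in
/-- Joint continuity of `𝒢` along a continuous curve. [folklore] -/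
theorem continuousOn_pcoFourG_family (hε : 0 ≤ ε) {γ : ℝ → Blocks} {S : Set ℝ} (hγ : ContinuousOn γ S)
    (Kset : Set (PP × UU)) :
    ContinuousOn (fun z : ℝ × (PP × UU) ↦ pcoFourG K ε (γ z.1) z.2) (S ×ˢ Kset) := by
  have h1 : ContinuousOn (fun z : ℝ × (PP × UU) ↦ γ z.1) (S ×ˢ Kset) :=
    hγ.comp continuousOn_fst fun z hz ↦ (Set.mem_prod.1 hz).1
  exact (continuous_pcoFourG K ε hε).continuousOn.comp (h1.prodMk continuousOn_snd) (Set.mapsTo_univ _ _)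

attribute [local irreducible] pcoFourG' in
/-- Joint continuity of `𝒢'` along a continuous solution. [folklore] -/
theorem continuousOn_pcoFourG'_family (hε : 0 ≤ ε) {γ : ℝ → Blocks} {S : Set ℝ} (hγ : ContinuousOn γ S)
    (Kset : Set (PP × UU)) :
    ContinuousOn (fun z : ℝ × (PP × UU) ↦ pcoFourG' K ε (γ z.1) (field (γ z.1)) z.2) (S ×ˢ Kset) := by
  have h1 : ContinuousOn (fun z : ℝ × (PP × UU) ↦ γ z.1) (S ×ˢ Kset) :=
    hγ.comp continuousOn_fst fun z hz ↦ (Set.mem_prod.1 hz).1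
  exact (continuous_pcoFourG' K ε hε).continuousOn.comp
    (h1.prodMk ((continuous_field.comp_continuousOn h1).prodMk continuousOn_snd)) (Set.mapsTo_univ _ _)

end Continuity

/-! ### The sign condition at a minimiser -/

/-- **Decoupling at a minimiser of `𝒢` with `𝒢 ≤ 0`**: `Y ≠ 0`, `w` and `z` minimise the
Rayleigh quotients, and the frames maximise `Y²`. [folklore] -/
theorem pcoFour_decouple {K ε : ℝ} (hK : 0 < K) (hε : 0 < ε) {A B C : Matrix (Fin 3) (Fin 3) ℝ}
    {F : PP} {w z : Fin 3 → ℝ} (hF : F ∈ (pairSet ×ˢ pairSet : Set PP)) (hw : w ∈ unitSet)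
    (hz : z ∈ unitSet) (hXpos : 0 < w ⬝ᵥ (A *ᵥ w)) (hXCpos : 0 < z ⬝ᵥ (C *ᵥ z))
    (hrmin : IsMinOn (pcoFourG K ε (A, B, C)) pcoOneSet (F, (w, z)))
    (hG0 : pcoFourG K ε (A, B, C) (F, (w, z)) ≤ 0) :
    0 < kyFanQ B F ^ 2 ∧
      (∀ r ∈ unitSet, w ⬝ᵥ (A *ᵥ w) ≤ r ⬝ᵥ (A *ᵥ r)) ∧
      (∀ r ∈ unitSet, z ⬝ᵥ (C *ᵥ z) ≤ r ⬝ᵥ (C *ᵥ r)) ∧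
      (∀ F' ∈ (pairSet ×ˢ pairSet : Set PP), kyFanQ B F' ^ 2 ≤ kyFanQ B F ^ 2) := by
  have hp1 : 0 < 1 + ε / 2 := by linarith
  have hG0' : K * (w ⬝ᵥ (A *ᵥ w)) * (z ⬝ᵥ (C *ᵥ z)) - (kyFanQ B F ^ 2) ^ (1 + ε / 2) ≤ 0 := hG0
  have hΦpos : 0 < K * (w ⬝ᵥ (A *ᵥ w)) * (z ⬝ᵥ (C *ᵥ z)) := by positivity
  refine ⟨?_, ?_, ?_, ?_⟩
  · rcases (sq_nonneg (kyFanQ B F)).eq_or_lt with h | h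
    · rw [← h, Real.zero_rpow hp1.ne'] at hG0'
      linarith
    · exact h
  · intro r hr
    have h := hrmin (show (F, (r, z)) ∈ pcoOneSet from ⟨hF, hr, hz⟩)
    simp only [mem_setOf_eq, pcoFourG] at h
    have h0 : 0 < K * (z ⬝ᵥ (C *ᵥ z)) := by positivity
    by_contra hcon
    rw [not_le] at hcon
    have := mul_lt_mul_of_pos_left hcon h0
    linarith
  · intro r hr
    have h := hrmin (show (F, (w, r)) ∈ pcoOneSet from ⟨hF, hw, hr⟩)
    simp only [mem_setOf_eq, pcoFourG] at h
    have h0 : 0 < K * (w ⬝ᵥ (A *ᵥ w)) := by positivity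
    by_contra hcon
    rw [not_le] at hcon
    have := mul_lt_mul_of_pos_left hcon h0
    linarith
  · intro F' hF'
    have h := hrmin (show (F', (w, z)) ∈ pcoOneSet from ⟨hF', hw, hz⟩)
    simp only [mem_setOf_eq, pcoFourG] at h
    have h1 : (kyFanQ B F' ^ 2) ^ (1 + ε / 2) ≤ (kyFanQ B F ^ 2) ^ (1 + ε / 2) := by linarith
    exact (Real.rpow_le_rpow_iff (sq_nonneg _) (sq_nonneg _) hp1).1 h1

/-- **The logarithmic derivative bounds for (4) at the extremal configuration** (Hamilton 1986,
p. 173): with `(A, B, C) ∈ Z₃` (`pcoPinchingThree m G H J δ`), `w`, `z` minimisers of the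
Rayleigh quotients and a diagonal Ky Fan maximiser `(u₁, u₂), (v₁, v₂)` with `Y₀ > 0`, the scalar
bounds of `pcoFour_ell` hold (a maximiser `T` of `tr (BT)` supplies `b`).
[cite: Hamilton1986, §7, Cors. 7.5–7.6 and p. 173] -/
theorem pcoFour_logBounds {m G H J δ η ε : ℝ} (hm : 0 < m) (hG : 0 < G) (hJ : 0 < J)
    (hδ : 0 < δ) (hδ1 : δ ≤ 1) (hδH : 8 * H * δ ≤ 1) (hδGH : 4 * G * H * δ ^ 2 ≤ 1)
    (hη : 0 < η) (hη2 : η ≤ 1 / 2) (hηJ : 16 * 8 ^ δ * J * η ^ δ ≤ 1)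
    (hε : 0 ≤ ε) (hε1 : 12 * ε ≤ δ * η) (hε2 : 144 * ε ≤ η ^ 2)
    {A B C : Matrix (Fin 3) (Fin 3) ℝ} (hp : (A, B, C) ∈ pcoPinchingThree m G H J δ)
    {w z : Fin 3 → ℝ} (hw : w ⬝ᵥ w = 1) (hz : z ⬝ᵥ z = 1)
    (hminW : ∀ r ∈ unitSet, w ⬝ᵥ (A *ᵥ w) ≤ r ⬝ᵥ (A *ᵥ r))
    (hminZ : ∀ r ∈ unitSet, z ⬝ᵥ (C *ᵥ z) ≤ r ⬝ᵥ (C *ᵥ r))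
    {u₁ u₂ v₁ v₂ : Fin 3 → ℝ} (hu₁ : u₁ ⬝ᵥ u₁ = 1) (hu₂ : u₂ ⬝ᵥ u₂ = 1) (hu : u₁ ⬝ᵥ u₂ = 0)
    (hv₁ : v₁ ⬝ᵥ v₁ = 1) (hv₂ : v₂ ⬝ᵥ v₂ = 1) (hv : v₁ ⬝ᵥ v₂ = 0)
    (hmax₀ : ∀ u₁' u₂' v₁' v₂' : Fin 3 → ℝ, u₁' ⬝ᵥ u₁' = 1 → u₂' ⬝ᵥ u₂' = 1 → u₁' ⬝ᵥ u₂' = 0 →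
      v₁' ⬝ᵥ v₁' = 1 → v₂' ⬝ᵥ v₂' = 1 → v₁' ⬝ᵥ v₂' = 0 →
      u₁' ⬝ᵥ (B *ᵥ v₁') + u₂' ⬝ᵥ (B *ᵥ v₂') ≤ u₁ ⬝ᵥ (B *ᵥ v₁) + u₂ ⬝ᵥ (B *ᵥ v₂))
    (hdiag : u₁ ⬝ᵥ (B *ᵥ v₂) = 0) (hY0 : 0 < u₁ ⬝ᵥ (B *ᵥ v₁) + u₂ ⬝ᵥ (B *ᵥ v₂)) :
    ∃ ℓ : ℝ,
      (2 + ε) * (u₁ ⬝ᵥ ((A * B + B * C + (2 : ℝ) • B.sharp) *ᵥ v₁) +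
          u₂ ⬝ᵥ ((A * B + B * C + (2 : ℝ) • B.sharp) *ᵥ v₂)) ≤ ℓ * (u₁ ⬝ᵥ (B *ᵥ v₁) + u₂ ⬝ᵥ (B *ᵥ v₂)) ∧
      ℓ * ((w ⬝ᵥ (A *ᵥ w)) * (z ⬝ᵥ (C *ᵥ z))) ≤
        (w ⬝ᵥ ((A * A + B * Bᵀ + (2 : ℝ) • A.sharp) *ᵥ w)) * (z ⬝ᵥ (C *ᵥ z)) +
          (w ⬝ᵥ (A *ᵥ w)) * (z ⬝ᵥ ((C * C + Bᵀ * B + (2 : ℝ) • C.sharp) *ᵥ z)) := by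
  obtain ⟨⟨⟨hA, hC⟩, htr, hop, hone, h2A, h2C⟩, hthree⟩ := hp
  simp only at hA hC htr h2A h2C
  -- positivity of `x`, `x_c`
  have hX : m ≤ w ⬝ᵥ (A *ᵥ w) := by have := hop.quad_fst w; rw [hw, mul_one] at this; exact this
  have hXC : m ≤ z ⬝ᵥ (C *ᵥ z) := by have := hop.quad_snd_snd z; rw [hz, mul_one] at this; exact this
  have hXpos : 0 < w ⬝ᵥ (A *ᵥ w) := by linarith
  have hXCpos : 0 < z ⬝ᵥ (C *ᵥ z) := by linarith
  -- a maximiser `T` of `tr (BT)`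
  obtain ⟨T, hT, hmaxT⟩ := exists_isMaxTrace B
  have hW6 := traceW_ge_of_operatorGE hop hT
  have hW : 0 < A.trace - 2 * (B * T).trace + C.trace := by simp only [traceW] at hW6; linarith
  -- maximisers of the Rayleigh quotients and the eigenvalue bounds
  obtain ⟨u₃, hu₃, hMA⟩ := exists_rayleigh_max A
  obtain ⟨z₃, hz₃, hMC⟩ := exists_rayleigh_max C
  have hu₃1 : u₃ ⬝ᵥ u₃ = 1 := hu₃
  have hz₃1 : z₃ ⬝ᵥ z₃ = 1 := hz₃
  have hMA' : ∀ e : Fin 3 → ℝ, e ⬝ᵥ e = 1 → e ⬝ᵥ (A *ᵥ e) ≤ u₃ ⬝ᵥ (A *ᵥ u₃) := fun e he ↦ hMA e he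
  have hMC' : ∀ e : Fin 3 → ℝ, e ⬝ᵥ e = 1 → e ⬝ᵥ (C *ᵥ e) ≤ z₃ ⬝ᵥ (C *ᵥ z₃) := fun e he ↦ hMC e he
  obtain ⟨hxa, haM⟩ := trace_sub_min_sub_max_bounds (A := A) hw hu₃1 hminW hMA
  obtain ⟨hxca, hcM⟩ := trace_sub_min_sub_max_bounds (A := C) hz hz₃1 hminZ hMC
  -- `k = |κ| = b₁`, `μ = min(μ₁, μ₂) = b₂`
  have hkw := normSq_transpose_ge_kappa_sq hu₁ hu₂ hu hv₁ hv₂ hv hmax₀ hdiag w hw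
  have hkz := normSq_ge_kappa_sq hu₁ hu₂ hu hv₁ hv₂ hv hmax₀ hdiag z hz
  have hkB : ∀ e : Fin 3 → ℝ, e ⬝ᵥ e = 1 →
      |(u₁ ⨯₃ u₂) ⬝ᵥ (B *ᵥ (v₁ ⨯₃ v₂))| ^ 2 ≤ (B *ᵥ e) ⬝ᵥ (B *ᵥ e) := fun e he ↦ by
    rw [sq_abs]; exact normSq_ge_kappa_sq hu₁ hu₂ hu hv₁ hv₂ hv hmax₀ hdiag e he
  have hkμ : |(u₁ ⨯₃ u₂) ⬝ᵥ (B *ᵥ (v₁ ⨯₃ v₂))| ≤ min (u₁ ⬝ᵥ (B *ᵥ v₁)) (u₂ ⬝ᵥ (B *ᵥ v₂)) :=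
    le_min (kyFanMax_kappa_le_fst hu₁ hu₂ hu hv₁ hv₂ hv hmax₀) (kyFanMax_kappa_le_snd hu₁ hu₂ hu hv₁ hv₂ hv hmax₀)
  -- the differential bounds (Lemma 6.1)
  have hup := kyFanMax_upper_gap (A := A) (C := C) hu₁ hu₂ hu hv₁ hv₂ hv hmax₀ hdiag hMA' hMC'
    (fun e e' he he' hee' ↦ pairSum_le_trace_sub_min hminW he he' hee')
    (fun e e' he he' hee' ↦ pairSum_le_trace_sub_min hminZ he he' hee')
  have hm2 : 0 < 2 * m := by positivity
  have hlowA := rayleighMin_field_ge (B := B) hA hm2 hop.twoSmallestEigenvaluesSumGE_fst hw hu₃1 hminW hMA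
  have hlowC := rayleighMin_field_ge (A := C) (B := Bᵀ) hC hm2 hop.twoSmallestEigenvaluesSumGE_snd_snd
    hz hz₃1 hminZ hMC
  rw [Matrix.transpose_transpose] at hlowC
  -- the algebraic inputs of Lemma 7.3
  have h2A' : u₃ ⬝ᵥ (A *ᵥ u₃) ≤ H * (w ⬝ᵥ (A *ᵥ w)) := by
    have := h2A u₃ w hu₃1 hw; rwa [add_zero] at this
  have h2C' : z₃ ⬝ᵥ (C *ᵥ z₃) ≤ H * (z ⬝ᵥ (C *ᵥ z)) := by
    have := h2C z₃ z hz₃1 hz; rwa [add_zero] at this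
  have hone' := hone u₁ u₂ v₁ v₂ w z hu₁ hu₂ hu hv₁ hv₂ hv hw hz
  obtain ⟨e₀, he₀, he₀le⟩ := exists_unit_rayleigh_le_trace_div_three C
  obtain ⟨f₀, hf₀, hf₀le⟩ := exists_unit_rayleigh_le_trace_div_three A
  have hXCle : z ⬝ᵥ (C *ᵥ z) ≤ H * (w ⬝ᵥ (A *ᵥ w)) := by
    have h1 := hminZ e₀ he₀
    rw [← htr] at he₀le
    linarith
  have hXle : w ⬝ᵥ (A *ᵥ w) ≤ H * (z ⬝ᵥ (C *ᵥ z)) := by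
    have h1 := hminW f₀ hf₀
    rw [htr] at hf₀le
    linarith
  have hY2A : (u₁ ⬝ᵥ (B *ᵥ v₁) + u₂ ⬝ᵥ (B *ᵥ v₂)) ^ 2 ≤ G * H * (w ⬝ᵥ (A *ᵥ w)) ^ 2 := by
    have t := mul_le_mul_of_nonneg_left hXCle (mul_nonneg hG.le hXpos.le)
    simp only at hone'
    linarith
  have hY2C : (u₁ ⬝ᵥ (B *ᵥ v₁) + u₂ ⬝ᵥ (B *ᵥ v₂)) ^ 2 ≤ G * H * (z ⬝ᵥ (C *ᵥ z)) ^ 2 := by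
    have t := mul_le_mul_of_nonneg_left hXle (mul_nonneg hG.le hXCpos.le)
    simp only at hone'
    linarith
  -- the inputs of Cors. 7.5, 7.6: (3) at the configuration, `2k ≤ Mᴬ + Mᶜ`, `3k ≤ b ≤ 2Y`
  have hthree' := hthree u₁ u₂ v₁ v₂ w z T hu₁ hu₂ hu hv₁ hv₂ hv hw hz hT
  simp only at hthree'
  have hkhalf := abs_cross_le_half hm.le hop hMA' hMC' (dotProduct_cross_self_of_orthonormal hu₁ hu₂ hu)
    (dotProduct_cross_self_of_orthonormal hv₁ hv₂ hv)
  have hb3k := three_mul_le_trace_mul_maxTrace hmaxT hT hkB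
  have hbY := trace_mul_le_two_mul_kyFanMax (B := B) hT
    (fun u₁' u₂' v₁' v₂' a b c d e f ↦ hmax₀ u₁' u₂' v₁' v₂' a b c d e f)
  exact pcoFour_ell hXpos hXCpos hY0 hδ hδ1 hδH hδGH hJ.le hη hη2 hηJ hε hε1 hε2 hxa haM h2A' hxca hcM
    h2C' (abs_nonneg _) hkμ hY2A hY2C (by rw [sq_abs]; exact hkw) (by rw [sq_abs]; exact hkz) hlowA hlowC
    hup htr.symm (by linarith [hkhalf]) hb3k hbY hW hthree'

/-- **`Φ'/Φ ≤ 2R/m`** in multiplied form: `X' x_c + x X_C' ≤ (2R/m) x x_c` for `X', X_C' ≤ R`,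
`x, x_c ≥ m`. [folklore] -/
theorem pcoFour_lPhi_le {m R : ℝ} (hm : 0 < m) {p p' : Blocks} {w z : Fin 3 → ℝ} (hw : w ⬝ᵥ w = 1)
    (hz : z ⬝ᵥ z = 1) (hX : m ≤ w ⬝ᵥ (p.1 *ᵥ w)) (hXC : m ≤ z ⬝ᵥ (p.2.2 *ᵥ z))
    (hR : (∑ k, ∑ l, |p'.1 k l|) + (∑ k, ∑ l, |p'.2.1 k l|) + ∑ k, ∑ l, |p'.2.2 k l| ≤ R) :
    (w ⬝ᵥ (p'.1 *ᵥ w)) * (z ⬝ᵥ (p.2.2 *ᵥ z)) + (w ⬝ᵥ (p.1 *ᵥ w)) * (z ⬝ᵥ (p'.2.2 *ᵥ z)) ≤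
      2 * R / m * ((w ⬝ᵥ (p.1 *ᵥ w)) * (z ⬝ᵥ (p.2.2 *ᵥ z))) := by
  have hA'nn : 0 ≤ ∑ k, ∑ l, |p'.1 k l| := Finset.sum_nonneg fun k _ ↦ Finset.sum_nonneg fun l _ ↦ abs_nonneg _
  have hB'nn : 0 ≤ ∑ k, ∑ l, |p'.2.1 k l| := Finset.sum_nonneg fun k _ ↦ Finset.sum_nonneg fun l _ ↦ abs_nonneg _
  have hC'nn : 0 ≤ ∑ k, ∑ l, |p'.2.2 k l| := Finset.sum_nonneg fun k _ ↦ Finset.sum_nonneg fun l _ ↦ abs_nonneg _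
  have hR0 : 0 ≤ R := by linarith
  have b1 : w ⬝ᵥ (p'.1 *ᵥ w) ≤ R := by
    have h1 := (abs_le.1 (abs_quad_le_sum p'.1 hw)).2
    linarith
  have b2 : z ⬝ᵥ (p'.2.2 *ᵥ z) ≤ R := by
    have h1 := (abs_le.1 (abs_quad_le_sum p'.2.2 hz)).2
    linarith
  clear hR hA'nn hB'nn hC'nn
  generalize w ⬝ᵥ (p'.1 *ᵥ w) = X' at b1 ⊢
  generalize z ⬝ᵥ (p'.2.2 *ᵥ z) = XC' at b2 ⊢
  generalize w ⬝ᵥ (p.1 *ᵥ w) = x at hX ⊢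
  generalize z ⬝ᵥ (p.2.2 *ᵥ z) = xc at hXC ⊢
  have hx : 0 < x := by linarith
  have hxc : 0 < xc := by linarith
  have e : 2 * R / m * (x * xc) = R / m * x * xc + R / m * xc * x := by ring
  rw [e]
  have t1 : X' ≤ R / m * x := by
    have : R ≤ R / m * x := by
      rw [div_mul_eq_mul_div, le_div_iff₀ hm]
      exact mul_le_mul_of_nonneg_left hX hR0
    linarith
  have t2 : XC' ≤ R / m * xc := by
    have : R ≤ R / m * xc := by
      rw [div_mul_eq_mul_div, le_div_iff₀ hm]
      exact mul_le_mul_of_nonneg_left hXC hR0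
    linarith
  have a1 := mul_le_mul_of_nonneg_right t1 hxc.le
  have a2 := mul_le_mul_of_nonneg_right t2 hx.le
  linarith

/-- **The sign condition at a minimiser of `𝒢`** (Hamilton 1986, p. 173): for `(A, B, C) ∈ Z₃`,
the constants as in `pcoFour_logBounds`, `0 < K`, `0 < ε`, and `R ≥ Σ|A'| + Σ|B'| + Σ|C'|`, at a
minimiser `q` of `𝒢` with `𝒢(q) ≤ 0`: `(2R/m) 𝒢(q) ≤ 𝒢'(q)`. [cite: Hamilton1986, §7, p. 173] -/
theorem pcoFour_sign {m G H J δ η K ε R : ℝ} (hm : 0 < m) (hG : 0 < G) (hJ : 0 < J)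
    (hδ : 0 < δ) (hδ1 : δ ≤ 1) (hδH : 8 * H * δ ≤ 1) (hδGH : 4 * G * H * δ ^ 2 ≤ 1)
    (hη : 0 < η) (hη2 : η ≤ 1 / 2) (hηJ : 16 * 8 ^ δ * J * η ^ δ ≤ 1) (hK : 0 < K)
    (hε : 0 < ε) (hε1 : 12 * ε ≤ δ * η) (hε2 : 144 * ε ≤ η ^ 2) {p : Blocks}
    (hp : p ∈ pcoPinchingThree m G H J δ)
    (hR : (∑ k, ∑ l, |(field p).1 k l|) + (∑ k, ∑ l, |(field p).2.1 k l|) +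
      ∑ k, ∑ l, |(field p).2.2 k l| ≤ R)
    {q : PP × UU} (hq : q ∈ pcoOneSet) (hqmin : IsMinOn (pcoFourG K ε p) pcoOneSet q)
    (hG0 : pcoFourG K ε p q ≤ 0) :
    2 * R / m * pcoFourG K ε p q ≤ pcoFourG' K ε p (field p) q := by
  obtain ⟨F, w, z⟩ := q
  obtain ⟨hF, hw, hz⟩ := hq
  obtain ⟨A, B, C⟩ := p
  have hop : OperatorGE (A, B, C) m := hp.1.2.2.1
  simp only at hF hw hz
  have hw1 : w ⬝ᵥ w = 1 := hw
  have hz1 : z ⬝ᵥ z = 1 := hz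
  have hX : m ≤ w ⬝ᵥ (A *ᵥ w) := by have := hop.quad_fst w; rw [hw1, mul_one] at this; exact this
  have hXC : m ≤ z ⬝ᵥ (C *ᵥ z) := by have := hop.quad_snd_snd z; rw [hz1, mul_one] at this; exact this
  have hXpos : 0 < w ⬝ᵥ (A *ᵥ w) := by linarith
  have hXCpos : 0 < z ⬝ᵥ (C *ᵥ z) := by linarith
  -- decoupling
  obtain ⟨hY2pos, hminW, hminZ, hmaxF⟩ := pcoFour_decouple hK hε hF hw hz hXpos hXCpos hqmin hG0
  -- flip to a non-negative maximiser, then rotate to a diagonal one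
  obtain ⟨Fb, hFb, hYnn, hflip⟩ : ∃ Fb ∈ (pairSet ×ˢ pairSet : Set PP), 0 ≤ kyFanQ B Fb ∧
      ∃ σ : ℝ, σ ^ 2 = 1 ∧ ∀ X : Matrix (Fin 3) (Fin 3) ℝ, kyFanQ X Fb = σ * kyFanQ X F := by
    rcases le_or_gt 0 (kyFanQ B F) with h | h
    · exact ⟨F, hF, h, 1, by norm_num, fun X ↦ by ring⟩
    · exact ⟨_, flip_mem hF, by rw [kyFanQ_flip]; linarith, -1, by norm_num, fun X ↦ by rw [kyFanQ_flip]; ring⟩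
  obtain ⟨σ, hσ, hσX⟩ := hflip
  have hmaxb : ∀ F' ∈ (pairSet ×ˢ pairSet : Set PP), kyFanQ B F' ≤ kyFanQ B Fb := by
    intro F' hF'
    have h1 := hmaxF F' hF'
    have h2 : kyFanQ B Fb ^ 2 = kyFanQ B F ^ 2 := by rw [hσX B, mul_pow, hσ, one_mul]
    rw [← h2] at h1
    nlinarith [abs_le_abs (le_abs_self (kyFanQ B F')) (neg_le_abs _), sq_abs (kyFanQ B F'),
      abs_nonneg (kyFanQ B F')]
  obtain ⟨F₀, hF₀, hF₀X, hdiag⟩ := exists_diag_maximiser hFb hmaxb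
  obtain ⟨⟨u₁, u₂⟩, ⟨v₁, v₂⟩⟩ := F₀
  obtain ⟨⟨hu₁, hu₂, hu⟩, ⟨hv₁, hv₂, hv⟩⟩ := hF₀
  simp only at hdiag hF₀X hu₁ hu₂ hu hv₁ hv₂ hv
  have hmax₀ : ∀ u₁' u₂' v₁' v₂' : Fin 3 → ℝ, u₁' ⬝ᵥ u₁' = 1 → u₂' ⬝ᵥ u₂' = 1 → u₁' ⬝ᵥ u₂' = 0 →
      v₁' ⬝ᵥ v₁' = 1 → v₂' ⬝ᵥ v₂' = 1 → v₁' ⬝ᵥ v₂' = 0 →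
      u₁' ⬝ᵥ (B *ᵥ v₁') + u₂' ⬝ᵥ (B *ᵥ v₂') ≤ u₁ ⬝ᵥ (B *ᵥ v₁) + u₂ ⬝ᵥ (B *ᵥ v₂) := by
    intro u₁' u₂' v₁' v₂' a b c d e f
    have h := hmaxb ((u₁', u₂'), (v₁', v₂')) ⟨⟨a, b, c⟩, ⟨d, e, f⟩⟩
    rw [← hF₀X B] at h
    exact h
  -- `Y₀ = |Y| > 0`, `Y₀ Y₀' = Y Y'`, `Y₀² = Y²`
  have hY0 : 0 ≤ u₁ ⬝ᵥ (B *ᵥ v₁) + u₂ ⬝ᵥ (B *ᵥ v₂) := by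
    have h1 : u₁ ⬝ᵥ (B *ᵥ v₁) + u₂ ⬝ᵥ (B *ᵥ v₂) = kyFanQ B Fb := hF₀X B
    rw [h1]; exact hYnn
  have hYY : ∀ X : Matrix (Fin 3) (Fin 3) ℝ,
      (u₁ ⬝ᵥ (B *ᵥ v₁) + u₂ ⬝ᵥ (B *ᵥ v₂)) * (u₁ ⬝ᵥ (X *ᵥ v₁) + u₂ ⬝ᵥ (X *ᵥ v₂)) =
        kyFanQ B F * kyFanQ X F := by
    intro X
    have h1 : u₁ ⬝ᵥ (B *ᵥ v₁) + u₂ ⬝ᵥ (B *ᵥ v₂) = σ * kyFanQ B F := (hF₀X B).trans (hσX B)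
    have h2 : u₁ ⬝ᵥ (X *ᵥ v₁) + u₂ ⬝ᵥ (X *ᵥ v₂) = σ * kyFanQ X F := (hF₀X X).trans (hσX X)
    rw [h1, h2]
    linear_combination (kyFanQ B F * kyFanQ X F) * hσ
  have hY2 : (u₁ ⬝ᵥ (B *ᵥ v₁) + u₂ ⬝ᵥ (B *ᵥ v₂)) ^ 2 = kyFanQ B F ^ 2 := by rw [sq, hYY B, sq]
  have hY0pos : 0 < u₁ ⬝ᵥ (B *ᵥ v₁) + u₂ ⬝ᵥ (B *ᵥ v₂) := by
    rcases hY0.eq_or_lt with h | h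
    · rw [← h] at hY2; nlinarith
    · exact h
  -- the logarithmic bounds and `Φ'/Φ ≤ 2R/m`
  obtain ⟨ℓ, hℓ1, hℓ2⟩ := pcoFour_logBounds hm hG hJ hδ hδ1 hδH hδGH hη hη2 hηJ hε.le hε1 hε2 hp
    hw1 hz1 hminW hminZ hu₁ hu₂ hu hv₁ hv₂ hv hmax₀ hdiag hY0pos
  have hC3 := pcoFour_lPhi_le (p := (A, B, C)) (p' := field (A, B, C)) hm hw1 hz1 hX hXC hR
  have hYY' := hYY (field (A, B, C)).2.1
  clear hR hqmin hmaxF hmaxb hmax₀ hF₀X hσX hminW hminZ hp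
  -- unfold `𝒢`, `𝒢'` at `q` and pass to scalars
  simp only [pcoFourG, pcoFourG'] at hG0 ⊢
  simp only [field] at hℓ1 hℓ2 hC3 hYY' hG0 ⊢
  rw [← hY2] at hY2pos hG0 ⊢
  generalize hY0E : u₁ ⬝ᵥ (B *ᵥ v₁) + u₂ ⬝ᵥ (B *ᵥ v₂) = Y₀ at hℓ1 hY0pos hYY' hY2pos hG0 ⊢
  have hSp1 : 0 < (Y₀ ^ 2) ^ (ε / 2) := Real.rpow_pos_of_pos hY2pos _
  have hSp : (Y₀ ^ 2) ^ (1 + ε / 2) = (Y₀ ^ 2) ^ (ε / 2) * Y₀ ^ 2 := by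
    rw [add_comm, Real.rpow_add hY2pos, Real.rpow_one]
  rw [hSp] at hG0 ⊢
  generalize (Y₀ ^ 2) ^ (ε / 2) = Sp1 at hSp1 hG0 ⊢
  generalize w ⬝ᵥ (A *ᵥ w) = x at hX hXpos hℓ2 hC3 hG0 ⊢
  generalize z ⬝ᵥ (C *ᵥ z) = xc at hXC hXCpos hℓ2 hC3 hG0 ⊢
  generalize w ⬝ᵥ ((A * A + B * Bᵀ + (2 : ℝ) • A.sharp) *ᵥ w) = X' at hℓ2 hC3 ⊢
  generalize z ⬝ᵥ ((C * C + Bᵀ * B + (2 : ℝ) • C.sharp) *ᵥ z) = XC' at hℓ2 hC3 ⊢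
  generalize u₁ ⬝ᵥ ((A * B + B * C + (2 : ℝ) • B.sharp) *ᵥ v₁) + u₂ ⬝ᵥ ((A * B + B * C + (2 : ℝ) • B.sharp) *ᵥ v₂) = Y₀'
    at hℓ1 hYY' ⊢
  generalize kyFanQ B F = Y at hYY' ⊢
  generalize kyFanQ (A * B + B * C + (2 : ℝ) • B.sharp) F = Y' at hYY' ⊢
  have hpos2 : 0 < x * xc := by positivity
  have hℓ3 : ℓ ≤ 2 * R / m := le_of_mul_le_mul_right (hℓ2.trans hC3) hpos2
  have hle : K * x * xc - Sp1 * Y₀ ^ 2 ≤ 0 := hG0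
  have p1 := mul_le_mul_of_nonneg_left hℓ2 hK.le
  have p2 := mul_le_mul_of_nonneg_left hℓ1 (show 0 ≤ Sp1 * Y₀ by positivity)
  have p4 := mul_nonneg_of_nonpos_of_nonpos hle (sub_nonpos.2 hℓ3)
  have eY : 2 * Y * Y' = 2 * (Y₀ * Y₀') := by rw [hYY']; ring
  rw [eY]
  linarith [p1, p2, p4]

/-! ### Thm. 7.1 (4), ODE part -/

/-- **Hamilton 1986, Thm. 7.1, inequality (4), ODE part (proved)**: for `0 < m, G, J, K`,
`0 < δ ≤ 1`, `8Hδ ≤ 1`, `4GHδ² ≤ 1`, an auxiliary `0 < η ≤ ½` with `16 · 8^δ J η^δ ≤ 1`, and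
`0 < ε` with `12ε ≤ δη`, `144ε ≤ η²`, the set `{(b₂ + b₃)^{2+ε} ≤ K a₁c₁}` is forward invariant
under Hamilton's ODE relative to `Z₃ = pcoPinchingThree m G H J δ` ("the inequality
`(b₂ + b₃)^{2+ε} ≤ K a₁c₁` is preserved for any `K`", p. 173). [cite: Hamilton1986, §7, Thm. 7.1 (4) (pp. 170, 173)] -/
theorem hamilton1986_pinchingFour_ode {m G H J δ η K ε : ℝ} (hm : 0 < m) (hG : 0 < G) (hJ : 0 < J)
    (hδ : 0 < δ) (hδ1 : δ ≤ 1) (hδH : 8 * H * δ ≤ 1) (hδGH : 4 * G * H * δ ^ 2 ≤ 1)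
    (hη : 0 < η) (hη2 : η ≤ 1 / 2) (hηJ : 16 * 8 ^ δ * J * η ^ δ ≤ 1) (hK : 0 < K)
    (hε : 0 < ε) (hε1 : 12 * ε ≤ δ * η) (hε2 : 144 * ε ≤ η ^ 2) :
    IsInvariantRel field (fun _ ↦ pcoPinchingThree m G H J δ)
      (fun _ ↦ {p | SingularValuesSumPowLEProd p K ε}) := by
  intro γ t₀ t₁ _ h₁ hγ hK' hin
  have hγc := IsSolutionOn.continuousOn hγ
  have hGc := continuousOn_pcoFourG_family K ε hε.le hγc pcoOneSet
  have hG'c := continuousOn_pcoFourG'_family K ε hε.le hγc pcoOneSet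
  have hGd : ∀ q ∈ pcoOneSet, ∀ s ∈ Icc t₀ t₁, _root_.HasDerivAt (fun t ↦ pcoFourG K ε (γ t) q)
      (pcoFourG' K ε (γ s) (field (γ s)) q) s := fun q _ s hs ↦ hasDerivAt_pcoFourG K hε (hγ s hs) q
  -- uniform bound `R` for `Σ|A'| + Σ|B'| + Σ|C'|`
  have hent : ∀ {f : Blocks → Matrix (Fin 3) (Fin 3) ℝ}, Continuous f →
      ContinuousOn (fun t ↦ ∑ k, ∑ l, |f (field (γ t)) k l|) (Icc t₀ t₁) := by
    intro f hf
    have h : ContinuousOn (fun t ↦ f (field (γ t))) (Icc t₀ t₁) :=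
      (hf.comp continuous_field).comp_continuousOn hγc
    exact continuousOn_finsetSum _ fun k _ ↦ continuousOn_finsetSum _ fun l _ ↦
      ((continuousOn_pi.1 (continuousOn_pi.1 h k) l)).abs
  have hScont : ContinuousOn (fun t ↦ (∑ k, ∑ l, |(field (γ t)).1 k l|) +
      (∑ k, ∑ l, |(field (γ t)).2.1 k l|) + ∑ k, ∑ l, |(field (γ t)).2.2 k l|) (Icc t₀ t₁) :=
    ((hent (f := fun p ↦ p.1) continuous_fst).add
      (hent (f := fun p ↦ p.2.1) (continuous_fst.comp continuous_snd))).add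
      (hent (f := fun p ↦ p.2.2) (continuous_snd.comp continuous_snd))
  obtain ⟨sR, -, hR⟩ := isCompact_Icc.exists_isMaxOn (nonempty_Icc.2 h₁) hScont
  set R := (∑ k, ∑ l, |(field (γ sR)).1 k l|) + (∑ k, ∑ l, |(field (γ sR)).2.1 k l|) +
    ∑ k, ∑ l, |(field (γ sR)).2.2 k l| with hRdef
  have hR' : ∀ s ∈ Icc t₀ t₁, (∑ k, ∑ l, |(field (γ s)).1 k l|) + (∑ k, ∑ l, |(field (γ s)).2.1 k l|) +
      ∑ k, ∑ l, |(field (γ s)).2.2 k l| ≤ R := fun s hs ↦ hR hs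
  have hR0 : 0 ≤ R := le_trans (add_nonneg (add_nonneg
    (Finset.sum_nonneg fun k _ ↦ Finset.sum_nonneg fun l _ ↦ abs_nonneg _)
    (Finset.sum_nonneg fun k _ ↦ Finset.sum_nonneg fun l _ ↦ abs_nonneg _))
    (Finset.sum_nonneg fun k _ ↦ Finset.sum_nonneg fun l _ ↦ abs_nonneg _)) (hR' t₀ (left_mem_Icc.2 h₁))
  have hC0 : 0 ≤ 2 * R / m := by positivity
  have key := minOverSet_nonneg_of_deriv (G := fun t q ↦ pcoFourG K ε (γ t) q)
    (G' := fun t q ↦ pcoFourG' K ε (γ t) (field (γ t)) q) isCompact_pcoOneSet pcoOneSet_nonempty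
    hGc hGd hG'c h₁ one_pos hC0 (η := 1) (fun s hs q hq hqmin _ hG0 ↦ ?_) ?_
  · rw [mem_setOf_eq, singularValuesSumPowLEProd_iff]
    exact (le_minOverSet_iff isCompact_pcoOneSet pcoOneSet_nonempty (continuousOn_slice
      (G := fun t q ↦ pcoFourG K ε (γ t) q) hGc (right_mem_Icc.2 h₁)) 0).1 key
  · have hsI : s ∈ Icc t₀ t₁ := Ico_subset_Icc_self hs
    exact pcoFour_sign hm hG hJ hδ hδ1 hδH hδGH hη hη2 hηJ hK hε hε1 hε2 (hK' s hsI) (hR' s hsI) hq hqmin hG0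
  · refine (le_minOverSet_iff isCompact_pcoOneSet pcoOneSet_nonempty (continuousOn_slice
      (G := fun t q ↦ pcoFourG K ε (γ t) q) hGc (left_mem_Icc.2 h₁)) 0).2 ?_
    exact (singularValuesSumPowLEProd_iff K ε (γ t₀)).1 hin

/-! ### The first four groups together -/

/-- **The set cut out by the first four groups of inequalities of Thm. 7.1** on `{M ≥ m}`:
`Z₄ = Z₃ ∩ {(b₂ + b₃)^{2+ε} ≤ K a₁c₁}`. [cite: Hamilton1986, §7, Thm. 7.1 (1)–(4) (p. 170)] -/
def pcoPinchingFour (m G H J δ K ε : ℝ) : Set Blocks :=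
  pcoPinchingThree m G H J δ ∩ {p | SingularValuesSumPowLEProd p K ε}

/-- **`Z₄` is forward invariant under Hamilton's ODE** (constants as in
`hamilton1986_pinchingFour_ode` and `isInvariant_pcoPinchingThree`). [cite: Hamilton1986, §7, Thm. 7.1 (pp. 170–173)] -/
theorem isInvariant_pcoPinchingFour {m G H J δ η K ε : ℝ} (hm : 0 < m) (hG : 0 < G) (hH : G + 1 ≤ H)
    (hJ : 0 < J) (hδ : 0 < δ) (hδ1 : δ ≤ 1) (hδH : 8 * H * δ ≤ 1) (hδGH : 4 * G * H * δ ^ 2 ≤ 1)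
    (hη : 0 < η) (hη2 : η ≤ 1 / 2) (hηJ : 16 * 8 ^ δ * J * η ^ δ ≤ 1) (hK : 0 < K)
    (hε : 0 < ε) (hε1 : 12 * ε ≤ δ * η) (hε2 : 144 * ε ≤ η ^ 2) :
    IsInvariant field (fun _ ↦ pcoPinchingFour m G H J δ K ε) :=
  (isInvariant_pcoPinchingThree hm hG hH hJ hδ hδ1 hδH hδGH).inter_rel_self
    (hamilton1986_pinchingFour_ode hm hG hJ hδ hδ1 hδH hδGH hη hη2 hηJ hK hε hε1 hε2)

/-- The set (4) is closed (for `ε ≥ 0`). [folklore] -/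
theorem isClosed_singularValuesSumPowLEProd (K : ℝ) {ε : ℝ} (hε : 0 ≤ ε) :
    IsClosed {p : Blocks | SingularValuesSumPowLEProd p K ε} := by
  have e : {p : Blocks | SingularValuesSumPowLEProd p K ε} = ⋂ q ∈ pcoOneSet, {p | 0 ≤ pcoFourG K ε p q} := by
    ext p; simp only [mem_setOf_eq, singularValuesSumPowLEProd_iff, mem_iInter]
  rw [e]
  exact isClosed_biInter fun q _ ↦ isClosed_le continuous_const
    ((continuous_pcoFourG K ε hε).comp (continuous_id.prodMk continuous_const))

/-- `Z₄` is closed. [cite: Hamilton1986, §7, Thm. 7.1 (p. 170, "Clearly `Z` is closed")] -/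
theorem isClosed_pcoPinchingFour (m G H J K : ℝ) {δ ε : ℝ} (hδ : 0 ≤ δ) (hε : 0 ≤ ε) :
    IsClosed (pcoPinchingFour m G H J δ K ε) :=
  (isClosed_pcoPinchingThree m G H J hδ).inter (isClosed_singularValuesSumPowLEProd K hε)

/-- The set (4) is symmetric under `B ↦ -B`. [folklore] -/
theorem SingularValuesSumPowLEProd.reflectB {p : Blocks} {K ε : ℝ} (h : SingularValuesSumPowLEProd p K ε) :
    SingularValuesSumPowLEProd (reflectB p) K ε := by
  intro u₁ u₂ v₁ v₂ w z hu₁ hu₂ hu hv₁ hv₂ hv hw hz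
  have := h u₁ u₂ v₁ v₂ w z hu₁ hu₂ hu hv₁ hv₂ hv hw hz
  simp only [HamiltonODE.reflectB, Matrix.neg_mulVec, dotProduct_neg]
  convert this using 2
  ring

/-- `Z₄` is symmetric under `B ↦ -B`. [folklore] -/
theorem reflectB_mem_pcoPinchingFour {m G H J δ K ε : ℝ} {p : Blocks} (h : p ∈ pcoPinchingFour m G H J δ K ε) :
    reflectB p ∈ pcoPinchingFour m G H J δ K ε :=
  ⟨reflectB_mem_pcoPinchingThree h.1, SingularValuesSumPowLEProd.reflectB h.2⟩

/-- **(4) is convex on `{a₁, c₁ ≥ m}`, `m ≥ 0`, `K ≥ 0`, `ε > 0`** (chord form; `b₂ + b₃` convex,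
`(K a₁c₁)^{1/(2+ε)}` concave — the chord inequality `rpow_pow_combo_le` with constant third
factor). [cite: Hamilton1986, §7, Thm. 7.1 (p. 170); §6, Lemma 6.3 (p. 170)] -/
theorem SingularValuesSumPowLEProd.combo {x y : Blocks} {m K ε a b : ℝ} (hm : 0 ≤ m) (hK : 0 ≤ K)
    (hε : 0 < ε) (hxo : OperatorGE x m) (hyo : OperatorGE y m)
    (hx : SingularValuesSumPowLEProd x K ε) (hy : SingularValuesSumPowLEProd y K ε) (ha : 0 ≤ a)
    (hb : 0 ≤ b) (hab : a + b = 1) : SingularValuesSumPowLEProd (a • x + b • y) K ε := by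
  intro u₁ u₂ v₁ v₂ w z hu₁ hu₂ hu hv₁ hv₂ hv hw hz
  simp only [combo_fst, combo_snd_fst, combo_snd_snd]
  rw [two_quad_combo, quad_combo, quad_combo]
  have hX₁ : 0 ≤ w ⬝ᵥ (x.1 *ᵥ w) := by have := hxo.quad_fst w; rw [hw, mul_one] at this; linarith
  have hX₂ : 0 ≤ w ⬝ᵥ (y.1 *ᵥ w) := by have := hyo.quad_fst w; rw [hw, mul_one] at this; linarith
  have hZ₁ : 0 ≤ z ⬝ᵥ (x.2.2 *ᵥ z) := by have := hxo.quad_snd_snd z; rw [hz, mul_one] at this; linarith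
  have hZ₂ : 0 ≤ z ⬝ᵥ (y.2.2 *ᵥ z) := by have := hyo.quad_snd_snd z; rw [hz, mul_one] at this; linarith
  have h₁ := hx u₁ u₂ v₁ v₂ w z hu₁ hu₂ hu hv₁ hv₂ hv hw hz
  have h₂ := hy u₁ u₂ v₁ v₂ w z hu₁ hu₂ hu hv₁ hv₂ hv hw hz
  have key := rpow_pow_combo_le (W₁ := 1) (W₂ := 1) ha hb hK hε hX₁ hX₂ hZ₁ hZ₂ zero_le_one zero_le_one
    (by rw [Real.one_rpow, mul_one]; exact h₁) (by rw [Real.one_rpow, mul_one]; exact h₂)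
  rwa [mul_one, mul_one, hab, Real.one_rpow, mul_one] at key

/-- **`Z₄` is convex** for `m ≥ 0`, `G, J, K ≥ 0`, `δ, ε > 0`. [cite: Hamilton1986, §7, Thm. 7.1 (p. 170)] -/
theorem convex_pcoPinchingFour {m G J δ K ε : ℝ} (hm : 0 ≤ m) (hG : 0 ≤ G) (hJ : 0 ≤ J) (hδ : 0 < δ)
    (hK : 0 ≤ K) (hε : 0 < ε) (H : ℝ) : Convex ℝ (pcoPinchingFour m G H J δ K ε) := by
  rintro x ⟨hx3, hx4⟩ y ⟨hy3, hy4⟩ a b ha hb hab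
  exact ⟨convex_pcoPinchingThree hm hG hJ hδ H hx3 hy3 ha hb hab,
    SingularValuesSumPowLEProd.combo hm hK hε hx3.1.2.2.1 hy3.1.2.2.1 hx4 hy4 ha hb hab⟩

end HamiltonODE

end Literature.Geometry.Riemannian

end
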